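import Summits.QuantumFields.YangMills.Theorems.FluctuationComparisonRegPrIntLRunpairOrganFibreLawDefs
import HarnessLib

/-!
# Crux `FluctuationComparisonRegPrIntL` (stmt-QuantumFields-20520, rung R3), PATH-B organ, H-currency cone — (L48′) «KER′ OF THE SQUARE BLOCKS (I-law-L)sq ∕ (I-law-V4)sq FROM THE
# LAW'S MIXED RESPONSE»: SUPERSEDES, for the purpose of an HONEST letter set, ✓`…OrganTangentILawKerLOfScoreProfile` (L48a) and ✓`…OrganTangentILawKerV4OfScoreProfile` (L48b)

Cell `ym3-torus` (YM ladder rung R3 = continuum `SU(2)` Yang–Mills on the three-torus — a RUNG: NOT d = 4, NOT infinite volume, NOT a mass gap, NOT Clay).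
Width seat `ym-ust-20520-w5` (gen 25), `--kind proof --supports stmt-QuantumFields-20520 --as helper`, count-neutral, DEFINITION-FREE, default heartbeats,
no registry ∕ binder ∕ `Lines/` edit.  Over ✓`…RunpairOrganFibreLawDefs` (`wNum`) only.

ERRATUM (why (L48a)∕(L48b) are superseded).  Those doors split the `s′`-increment `Cov¹(h,Sc¹_s) − Cov⁰(h,Sc⁰_s)` as `Cov¹(h, Sc¹−Sc⁰) + [Cov¹−Cov⁰](h, Sc⁰)`, which puts the
score of the `s′ = 0` law under the `s′ = 1` law; their law-facts letter asks `Integrable (h·Sc⁰_s·Law_t(X s 1))`.  On the ABSOLUTE-cut organ (`wNum = mwCut(Φ)·smooth`,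
`Sc = ∂_s wNum ∕ wNum`) this FAILS generically: at the moving cut boundary of law 0 (a ramp of a plaquette influenced by both `B` and `B′`) `|Sc⁰| ~ |∂_s d_p| ∕ ramp(d_p⁰) → ∞`
while `ramp(d_p¹)` stays positive, and `∫ dτ ∕ ramp⁰` diverges logarithmically whenever the fibre distribution of `d_p⁰(z)` has a density at the kink.  Under its OWN law a
score is harmless (`Sc·Law = ∂_s wNum ∕ ∫wNum` pointwise), which is why the PATH doors (X ✓p825419, V3 ✓p825783) are unaffected.  The theorems of (L48a)∕(L48b)∕(L49b) remain
correct; their square hypotheses are not satisfiable here.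

WHY A NEAR-RESTATEMENT.  KER′(L)(s) `= ∫ h·(ν̃¹_s − ν̃⁰_s) dτ` EXACTLY with `ν̃^{s′}_s := Sc^{s′}_s·Law^{s′} − (∫ Sc^{s′}_s·Law^{s′})·Law^{s′} = ∂_s Law_t(X s s′)` (the
law's own tangent along `s`; pure linearity): a CONNECTED mixed second-order response `∂_s Δ_{s′} E[h]` of the expectation of the (flat, global) observable `h` to the two link
moves.  Any split into first-order objects is either cross-law (above) or disconnected (e.g. `(E¹h − E⁰h)·E⁰[Sc⁰_s]`, with no `tdist(B,B′)`-decay, hence no κ-row mass): the decay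
lives in the connected combination only.  The same holds for KER′(V4) `= Δ_{s′} κ₃^{(s,s′)}(h, h, Sc_s)` (a connected fourth-order response).  So the honest letters are the
mixed responses THEMSELVES, stated for PROFILED observables (print: second ∕ fourth background derivatives of expectations of local observables, tree decay in
{supp, B, B′} — [Balaban1987RG1] (2.13), [Balaban1985UV3] p.263 (c); bottom §76 G2-b) — SOURCES of the shapes only:
(MR-L^{prof}) «`|[∫ Pf·Sc¹_s·L¹ − (∫ Pf·L¹)(∫ Sc¹_s·L¹)] − [same at s′ = 0]| ≤ (‖m‖∕θc)(‖m′‖∕θc)·Σ_a |p a|·𝒢₁₁(a; B, B′)`»,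
(MR-V4^{prof}) «`|Δ_{s′} κ₃-display(Pf, Qf, Sc_s)| ≤ (‖m‖∕θc)(‖m′‖∕θc)·Σ_{a,b} |p a|·|q b|·𝒢₂₂(a, b; B, B′)`».

INHABITATION (★★OWNER RULING №100): (MR-L^{prof}) ∕ (MR-V4^{prof}) — inhabited by the tilted `m`-step fibre law's mixed (`∂_s`, `Δ_{s′}`) response; each bracket of the
display is an OWN-LAW number at its own `s′` (`∫ Pf·Sc^{s′}_s·Law^{s′}`, `∫ Pf·Law^{s′}`, `∫ Sc^{s′}_s·Law^{s′}`, with `Sc^{s′}·Law^{s′} = ∂_s wNum^{s′} ∕ ∫wNum^{s′}` pointwise,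
bounded by REG′'s `|b z| ∕ ∫wNum^{s′}`), and the letter bounds the DIFFERENCE of two own-law numbers — NO cross-law integrand anywhere (this is the point of the reshape);
(h-PROF) — law-free (a predicate on the observable `h_Ts∘Φ(V00,·)` and its flat profile `Kh`); the κ-row mass `hmass` — law-free (a numeric bound on the posited kernel).

WHAT.  §0 [folklore] `sizes_mr_eq`, `sizes_mr₂_eq` (pull the two sizes and the flat profile out).  §1 ★★`kerLClause_of_mixedResponse` ∕ ★★`kerV4Clause_of_mixedResponse₂` —
ABSTRACT DOORS on the square frame (`Fobs`, `Law`, `Sc : ℝ → (ℝ → G_j) → ℝ → Z → ℝ`, a profile predicate `Prof` indexed by the square's base corner): (MR-?^{prof}) + (h-PROF)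
`Prof V00 (Fobs V00) Kh` + the κ-row mass of the `Kh`-contracted kernel POSITED ⟹ `∃ k ≥ 0`, `t`-UNIFORM, κ-row mass `≤ M`, and the KER′ SHAPE for EVERY `s ∈ [0,1]` (hence
a.e.), `kL B B′ := Σ_a Kh a·𝒢₁₁ a B B′`, `kV₄ B B′ := Σ_{a,b} Kh a·Kh b·𝒢₂₂ a b B B′`; NO law-facts letter.  §2 ★★`kerL_organ_mr` ∕ ★★`kerV4_organ_mr` — the ORGAN DOCKS
(`Fobs := h_Ts∘Φ`, `Law := wNum_t ∕ ∫wNum_t`, `Sc t X′ s z := deriv (σ ↦ wNum_t (X′ σ) z) s ∕ wNum_t (X′ s) z`, `θc := θ_j∕4`): the KER′ conjunct texts of ✓p821651's `hIlawL` ∕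
`hIlawV4` VERBATIM.

HONEST FRAMING: doors between HYPOTHESIS letters — and here the letters (MR-L^{prof}), (MR-V4^{prof}) are NEAR-RESTATEMENTS of KER′(L), KER′(V4) BY NECESSITY (a connected
mixed second-order response admits no split into first-order objects that is both same-law and connected — see the erratum in the module docstring); what the doors add is the
NAME, the generalisation to profiled observables, the sizes and the κ-row-mass bookkeeping, and the absence of any law-facts letter.  Nothing of Bałaban's analysis is asserted
or proved; REG′ is ✓p823910's; (I-curv), (I-cov), `OrganDischargeInputsHJ(sq)` ∕ `SpreadFibreLawH(J)(sq)` UNDISCHARGED; the five registered stubs of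
`Lines/semiclassical_s2beta.lean`, crux 20520 and `YM3TorusSU2` are NOT proved; registry untouched; rung R3 = SU(2) YM₃ on T³ — NOT d = 4, NOT infinite volume, NOT a mass
gap, NOT Clay; the Yang–Mills mass gap is NOT proved.  [folklore]
-/

set_option autoImplicit false

noncomputable section

namespace Summit.QuantumFields.YangMills.Theorems.OrganTangentILawKerSqOfMixedResponse

open MeasureTheory
open scoped BigOperators
open Literature.MathematicalPhysics.QuantumFieldTheory.Balaban1983to89 T3ContinuumYM3Torus T3NestedUnitLaws
  T3UnitLawDensityEML T4Continuum BalabanUVClass T3UnitScaleTilt T3LevelShift T3TiltDescent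
open T4CubeChartExp (expPt)
open Summit.QuantumFields.YangMills.Theorems.FluctuationComparisonRegPrIntLRunpairOrganFibreLaw (wNum)

/-! ## §0 Folklore: sizes and the flat profile out -/

section Folklore

variable {ι ιc : Type*} [Fintype ι]

/-- `s·s′·Σ_a |Kh a|·𝒢 a = (Σ_a Kh a·𝒢 a)·s·s′` for `Kh ≥ 0`. [folklore] -/
theorem sizes_mr_eq (Kh : ι → ℝ) (𝒢 : ι → ℝ) (hKh : ∀ a, 0 ≤ Kh a) (s s' : ℝ) :
    s * s' * ∑ a, |Kh a| * 𝒢 a = (∑ a, Kh a * 𝒢 a) * s * s' := by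
  rw [show (∑ a, |Kh a| * 𝒢 a) = ∑ a, Kh a * 𝒢 a from Finset.sum_congr rfl fun a _ => by rw [abs_of_nonneg (hKh a)]]
  ring

/-- `s·s′·Σ_{a,b} |Kh a|·|Kh b|·𝒢 a b = (Σ_{a,b} Kh a·Kh b·𝒢 a b)·s·s′` for `Kh ≥ 0`. [folklore] -/
theorem sizes_mr₂_eq (Kh : ι → ℝ) (𝒢 : ι → ι → ℝ) (hKh : ∀ a, 0 ≤ Kh a) (s s' : ℝ) :
    s * s' * ∑ a, ∑ b, |Kh a| * |Kh b| * 𝒢 a b = (∑ a, ∑ b, Kh a * Kh b * 𝒢 a b) * s * s' := by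
  rw [show (∑ a, ∑ b, |Kh a| * |Kh b| * 𝒢 a b) = ∑ a, ∑ b, Kh a * Kh b * 𝒢 a b from
    Finset.sum_congr rfl fun a _ => Finset.sum_congr rfl fun b _ => by rw [abs_of_nonneg (hKh a), abs_of_nonneg (hKh b)]]
  ring

end Folklore

/-! ## §1 The abstract doors on the square frame -/

section Abstract

variable {P : Params} {j : ℕ} {ι : Type*} [Fintype ι] {Z : Type*} [MeasurableSpace Z]

/-- ★★ **KER′ OF THE (I-law-L)sq BLOCK ⟸ (MR-L^{prof}) × (h-PROF)** — abstract currency on the relational square; no law-facts letter. [folklore] -/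
theorem kerLClause_of_mixedResponse (τ : Measure Z) (Fobs : GaugeField P j ↥(Matrix.specialUnitaryGroup (Fin 2) ℂ) → Z → ℝ)
    (Law : ℝ → GaugeField P j ↥(Matrix.specialUnitaryGroup (Fin 2) ℂ) → Z → ℝ)
    (Sc : ℝ → (ℝ → GaugeField P j ↥(Matrix.specialUnitaryGroup (Fin 2) ℂ)) → ℝ → Z → ℝ)
    (θc rc κ M : ℝ)
    (Prof : GaugeField P j ↥(Matrix.specialUnitaryGroup (Fin 2) ℂ) → (Z → ℝ) → (ι → ℝ) → Prop)
    -- (MR-L^{prof}) the law's MIXED RESPONSE (`s`-score covariance, `s′`-increment) tested against a profiled observable; `Kh`-contracted κ-row mass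
    (𝒢₁₁ : ι → PBond P j → PBond P j → ℝ) (Kh : ι → ℝ) (hG0 : ∀ a B B', 0 ≤ 𝒢₁₁ a B B') (hKh0 : ∀ a, 0 ≤ Kh a)
    (hmass : ∀ B, ∑ B', (∑ a, Kh a * 𝒢₁₁ a B B') * Real.exp (κ * (B.src.tdist B'.src : ℝ)) ≤ M)
    (hMR : ∀ t : ℝ, 0 ≤ t → t ≤ 1 → ∀ (B B' : PBond P j) (m m' : Fin 3 → ℝ) (V00 V10 V01 V11 : GaugeField P j ↥(Matrix.specialUnitaryGroup (Fin 2) ℂ)),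
      ‖m‖ ≤ rc * θc → ‖m'‖ ≤ rc * θc → PlaqSmall θc V00 → PlaqSmall θc V10 → PlaqSmall θc V01 → PlaqSmall θc V11 →
      (∀ e, e ≠ B → V10 e = V00 e) → V10 B = V00 B * expPt m → (∀ e, e ≠ B' → V01 e = V00 e) → V01 B' = V00 B' * expPt m' →
      (∀ e, e ≠ B' → V11 e = V10 e) → V11 B' = V10 B' * expPt m' →
      ∀ (Y : ℝ → GaugeField P j ↥(Matrix.specialUnitaryGroup (Fin 2) ℂ)) (X : ℝ → ℝ → GaugeField P j ↥(Matrix.specialUnitaryGroup (Fin 2) ℂ)),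
      (∀ s e, e ≠ B → Y s e = V00 e) → (∀ s, Y s B = V00 B * expPt (s • m)) → (∀ s s' e, e ≠ B' → X s s' e = Y s e) → (∀ s s', X s s' B' = Y s B' * expPt (s' • m')) →
      ∀ s ∈ Set.Icc (0:ℝ) 1, ∀ (Pf : Z → ℝ) (p : ι → ℝ), Prof V00 Pf p →
        |(((∫ z, Pf z * Sc t (fun σ => X σ 1) s z * Law t (X s 1) z ∂τ) - (∫ z, Pf z * Law t (X s 1) z ∂τ) * (∫ z, Sc t (fun σ => X σ 1) s z * Law t (X s 1) z ∂τ)))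
            - (((∫ z, Pf z * Sc t (fun σ => X σ 0) s z * Law t (X s 0) z ∂τ) - (∫ z, Pf z * Law t (X s 0) z ∂τ) * (∫ z, Sc t (fun σ => X σ 0) s z * Law t (X s 0) z ∂τ)))|
          ≤ ‖m‖ / θc * (‖m'‖ / θc) * ∑ a, |p a| * 𝒢₁₁ a B B')
    -- (h-PROF) the flat profile of the fixed observable
    (hProfF : ∀ V00 : GaugeField P j ↥(Matrix.specialUnitaryGroup (Fin 2) ℂ), PlaqSmall θc V00 → Prof V00 (Fobs V00) Kh) :
    ∃ kL : PBond P j → PBond P j → ℝ, (∀ B B', 0 ≤ kL B B') ∧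
      (∀ B, ∑ B', kL B B' * Real.exp (κ * (B.src.tdist B'.src : ℝ)) ≤ M) ∧
      ∀ t : ℝ, 0 ≤ t → t ≤ 1 → ∀ (B B' : PBond P j) (m m' : Fin 3 → ℝ) (V00 V10 V01 V11 : GaugeField P j ↥(Matrix.specialUnitaryGroup (Fin 2) ℂ)),
        ‖m‖ ≤ rc * θc → ‖m'‖ ≤ rc * θc → PlaqSmall θc V00 → PlaqSmall θc V10 → PlaqSmall θc V01 → PlaqSmall θc V11 →
        (∀ e, e ≠ B → V10 e = V00 e) → V10 B = V00 B * expPt m → (∀ e, e ≠ B' → V01 e = V00 e) → V01 B' = V00 B' * expPt m' →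
        (∀ e, e ≠ B' → V11 e = V10 e) → V11 B' = V10 B' * expPt m' →
        ∀ (Y : ℝ → GaugeField P j ↥(Matrix.specialUnitaryGroup (Fin 2) ℂ)) (X : ℝ → ℝ → GaugeField P j ↥(Matrix.specialUnitaryGroup (Fin 2) ℂ)),
        (∀ s e, e ≠ B → Y s e = V00 e) → (∀ s, Y s B = V00 B * expPt (s • m)) → (∀ s s' e, e ≠ B' → X s s' e = Y s e) → (∀ s s', X s s' B' = Y s B' * expPt (s' • m')) →
        ∀ᵐ s ∂(volume : Measure ℝ), s ∈ Set.Icc (0:ℝ) 1 →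
          |(((∫ z, Fobs V00 z * Sc t (fun σ => X σ 1) s z * Law t (X s 1) z ∂τ) - (∫ z, Fobs V00 z * Law t (X s 1) z ∂τ) * (∫ z, Sc t (fun σ => X σ 1) s z * Law t (X s 1) z ∂τ)))
              - (((∫ z, Fobs V00 z * Sc t (fun σ => X σ 0) s z * Law t (X s 0) z ∂τ) - (∫ z, Fobs V00 z * Law t (X s 0) z ∂τ) * (∫ z, Sc t (fun σ => X σ 0) s z * Law t (X s 0) z ∂τ)))|
            ≤ kL B B' * (‖m‖ / θc) * (‖m'‖ / θc) := by
  refine ⟨fun B B' => ∑ a, Kh a * 𝒢₁₁ a B B', fun B B' => Finset.sum_nonneg fun a _ => mul_nonneg (hKh0 a) (hG0 a B B'), hmass, ?_⟩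
  intro t ht0 ht1 B B' m m' V00 V10 V01 V11 hm hm' h00 h10 h01 h11 h10off h10on h01off h01on h11off h11on Y X hYoff hYon hXoff hXon
  refine ae_of_all _ fun s hsI => ?_
  refine (hMR t ht0 ht1 B B' m m' V00 V10 V01 V11 hm hm' h00 h10 h01 h11 h10off h10on h01off h01on h11off h11on Y X hYoff hYon hXoff hXon
    s hsI _ _ (hProfF V00 h00)).trans (le_of_eq ?_)
  exact sizes_mr_eq Kh (fun a => 𝒢₁₁ a B B') hKh0 _ _

/-- ★★ **KER′ OF THE (I-law-V4)sq BLOCK ⟸ (MR-V4^{prof}) × (h-PROF)** — abstract currency on the relational square; no law-facts letter. [folklore] -/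
theorem kerV4Clause_of_mixedResponse₂ (τ : Measure Z) (Fobs : GaugeField P j ↥(Matrix.specialUnitaryGroup (Fin 2) ℂ) → Z → ℝ)
    (Law : ℝ → GaugeField P j ↥(Matrix.specialUnitaryGroup (Fin 2) ℂ) → Z → ℝ)
    (Sc : ℝ → (ℝ → GaugeField P j ↥(Matrix.specialUnitaryGroup (Fin 2) ℂ)) → ℝ → Z → ℝ)
    (θc rc κ M : ℝ)
    (Prof : GaugeField P j ↥(Matrix.specialUnitaryGroup (Fin 2) ℂ) → (Z → ℝ) → (ι → ℝ) → Prop)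
    -- (MR-V4^{prof}) the law's MIXED RESPONSE of the displayed third cumulant; `Kh`-doubly-contracted κ-row mass
    (𝒢₂₂ : ι → ι → PBond P j → PBond P j → ℝ) (Kh : ι → ℝ) (hG0 : ∀ a b B B', 0 ≤ 𝒢₂₂ a b B B') (hKh0 : ∀ a, 0 ≤ Kh a)
    (hmass : ∀ B, ∑ B', (∑ a, ∑ b, Kh a * Kh b * 𝒢₂₂ a b B B') * Real.exp (κ * (B.src.tdist B'.src : ℝ)) ≤ M)
    (hMR : ∀ t : ℝ, 0 ≤ t → t ≤ 1 → ∀ (B B' : PBond P j) (m m' : Fin 3 → ℝ) (V00 V10 V01 V11 : GaugeField P j ↥(Matrix.specialUnitaryGroup (Fin 2) ℂ)),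
      ‖m‖ ≤ rc * θc → ‖m'‖ ≤ rc * θc → PlaqSmall θc V00 → PlaqSmall θc V10 → PlaqSmall θc V01 → PlaqSmall θc V11 →
      (∀ e, e ≠ B → V10 e = V00 e) → V10 B = V00 B * expPt m → (∀ e, e ≠ B' → V01 e = V00 e) → V01 B' = V00 B' * expPt m' →
      (∀ e, e ≠ B' → V11 e = V10 e) → V11 B' = V10 B' * expPt m' →
      ∀ (Y : ℝ → GaugeField P j ↥(Matrix.specialUnitaryGroup (Fin 2) ℂ)) (X : ℝ → ℝ → GaugeField P j ↥(Matrix.specialUnitaryGroup (Fin 2) ℂ)),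
      (∀ s e, e ≠ B → Y s e = V00 e) → (∀ s, Y s B = V00 B * expPt (s • m)) → (∀ s s' e, e ≠ B' → X s s' e = Y s e) → (∀ s s', X s s' B' = Y s B' * expPt (s' • m')) →
      ∀ s ∈ Set.Icc (0:ℝ) 1, ∀ (Pf Qf : Z → ℝ) (p q : ι → ℝ), Prof V00 Pf p → Prof V00 Qf q →
        |((((∫ z, Pf z * Qf z * Sc t (fun σ => X σ 1) s z * Law t (X s 1) z ∂τ) - (∫ z, Pf z * Qf z * Law t (X s 1) z ∂τ) * (∫ z, Sc t (fun σ => X σ 1) s z * Law t (X s 1) z ∂τ))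
                - (((∫ z, Pf z * Sc t (fun σ => X σ 1) s z * Law t (X s 1) z ∂τ) - (∫ z, Pf z * Law t (X s 1) z ∂τ) * (∫ z, Sc t (fun σ => X σ 1) s z * Law t (X s 1) z ∂τ)) * (∫ z, Qf z * Law t (X s 1) z ∂τ)
                    + (∫ z, Pf z * Law t (X s 1) z ∂τ) * ((∫ z, Qf z * Sc t (fun σ => X σ 1) s z * Law t (X s 1) z ∂τ) - (∫ z, Qf z * Law t (X s 1) z ∂τ) * (∫ z, Sc t (fun σ => X σ 1) s z * Law t (X s 1) z ∂τ)))))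
            - ((((∫ z, Pf z * Qf z * Sc t (fun σ => X σ 0) s z * Law t (X s 0) z ∂τ) - (∫ z, Pf z * Qf z * Law t (X s 0) z ∂τ) * (∫ z, Sc t (fun σ => X σ 0) s z * Law t (X s 0) z ∂τ))
                - (((∫ z, Pf z * Sc t (fun σ => X σ 0) s z * Law t (X s 0) z ∂τ) - (∫ z, Pf z * Law t (X s 0) z ∂τ) * (∫ z, Sc t (fun σ => X σ 0) s z * Law t (X s 0) z ∂τ)) * (∫ z, Qf z * Law t (X s 0) z ∂τ)
                    + (∫ z, Pf z * Law t (X s 0) z ∂τ) * ((∫ z, Qf z * Sc t (fun σ => X σ 0) s z * Law t (X s 0) z ∂τ) - (∫ z, Qf z * Law t (X s 0) z ∂τ) * (∫ z, Sc t (fun σ => X σ 0) s z * Law t (X s 0) z ∂τ)))))|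
          ≤ ‖m‖ / θc * (‖m'‖ / θc) * ∑ a, ∑ b, |p a| * |q b| * 𝒢₂₂ a b B B')
    -- (h-PROF)
    (hProfF : ∀ V00 : GaugeField P j ↥(Matrix.specialUnitaryGroup (Fin 2) ℂ), PlaqSmall θc V00 → Prof V00 (Fobs V00) Kh) :
    ∃ kV₄ : PBond P j → PBond P j → ℝ, (∀ B B', 0 ≤ kV₄ B B') ∧
      (∀ B, ∑ B', kV₄ B B' * Real.exp (κ * (B.src.tdist B'.src : ℝ)) ≤ M) ∧
      ∀ t : ℝ, 0 ≤ t → t ≤ 1 → ∀ (B B' : PBond P j) (m m' : Fin 3 → ℝ) (V00 V10 V01 V11 : GaugeField P j ↥(Matrix.specialUnitaryGroup (Fin 2) ℂ)),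
        ‖m‖ ≤ rc * θc → ‖m'‖ ≤ rc * θc → PlaqSmall θc V00 → PlaqSmall θc V10 → PlaqSmall θc V01 → PlaqSmall θc V11 →
        (∀ e, e ≠ B → V10 e = V00 e) → V10 B = V00 B * expPt m → (∀ e, e ≠ B' → V01 e = V00 e) → V01 B' = V00 B' * expPt m' →
        (∀ e, e ≠ B' → V11 e = V10 e) → V11 B' = V10 B' * expPt m' →
        ∀ (Y : ℝ → GaugeField P j ↥(Matrix.specialUnitaryGroup (Fin 2) ℂ)) (X : ℝ → ℝ → GaugeField P j ↥(Matrix.specialUnitaryGroup (Fin 2) ℂ)),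
        (∀ s e, e ≠ B → Y s e = V00 e) → (∀ s, Y s B = V00 B * expPt (s • m)) → (∀ s s' e, e ≠ B' → X s s' e = Y s e) → (∀ s s', X s s' B' = Y s B' * expPt (s' • m')) →
        ∀ᵐ s ∂(volume : Measure ℝ), s ∈ Set.Icc (0:ℝ) 1 →
          |((((∫ z, Fobs V00 z * Fobs V00 z * Sc t (fun σ => X σ 1) s z * Law t (X s 1) z ∂τ) - (∫ z, Fobs V00 z * Fobs V00 z * Law t (X s 1) z ∂τ) * (∫ z, Sc t (fun σ => X σ 1) s z * Law t (X s 1) z ∂τ))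
                - (((∫ z, Fobs V00 z * Sc t (fun σ => X σ 1) s z * Law t (X s 1) z ∂τ) - (∫ z, Fobs V00 z * Law t (X s 1) z ∂τ) * (∫ z, Sc t (fun σ => X σ 1) s z * Law t (X s 1) z ∂τ)) * (∫ z, Fobs V00 z * Law t (X s 1) z ∂τ)
                    + (∫ z, Fobs V00 z * Law t (X s 1) z ∂τ) * ((∫ z, Fobs V00 z * Sc t (fun σ => X σ 1) s z * Law t (X s 1) z ∂τ) - (∫ z, Fobs V00 z * Law t (X s 1) z ∂τ) * (∫ z, Sc t (fun σ => X σ 1) s z * Law t (X s 1) z ∂τ)))))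
              - ((((∫ z, Fobs V00 z * Fobs V00 z * Sc t (fun σ => X σ 0) s z * Law t (X s 0) z ∂τ) - (∫ z, Fobs V00 z * Fobs V00 z * Law t (X s 0) z ∂τ) * (∫ z, Sc t (fun σ => X σ 0) s z * Law t (X s 0) z ∂τ))
                - (((∫ z, Fobs V00 z * Sc t (fun σ => X σ 0) s z * Law t (X s 0) z ∂τ) - (∫ z, Fobs V00 z * Law t (X s 0) z ∂τ) * (∫ z, Sc t (fun σ => X σ 0) s z * Law t (X s 0) z ∂τ)) * (∫ z, Fobs V00 z * Law t (X s 0) z ∂τ)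
                    + (∫ z, Fobs V00 z * Law t (X s 0) z ∂τ) * ((∫ z, Fobs V00 z * Sc t (fun σ => X σ 0) s z * Law t (X s 0) z ∂τ) - (∫ z, Fobs V00 z * Law t (X s 0) z ∂τ) * (∫ z, Sc t (fun σ => X σ 0) s z * Law t (X s 0) z ∂τ)))))|
            ≤ kV₄ B B' * (‖m‖ / θc) * (‖m'‖ / θc) := by
  refine ⟨fun B B' => ∑ a, ∑ b, Kh a * Kh b * 𝒢₂₂ a b B B',
    fun B B' => Finset.sum_nonneg fun a _ => Finset.sum_nonneg fun b _ => mul_nonneg (mul_nonneg (hKh0 a) (hKh0 b)) (hG0 a b B B'), hmass, ?_⟩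
  intro t ht0 ht1 B B' m m' V00 V10 V01 V11 hm hm' h00 h10 h01 h11 h10off h10on h01off h01on h11off h11on Y X hYoff hYon hXoff hXon
  refine ae_of_all _ fun s hsI => ?_
  refine (hMR t ht0 ht1 B B' m m' V00 V10 V01 V11 hm hm' h00 h10 h01 h11 h10off h10on h01off h01on h11off h11on Y X hYoff hYon hXoff hXon
    s hsI _ _ _ _ (hProfF V00 h00) (hProfF V00 h00)).trans (le_of_eq ?_)
  exact sizes_mr₂_eq Kh (fun a b => 𝒢₂₂ a b B B') hKh0 _ _

end Abstract

/-! ## §2 The organ docks: ✓p821651's `hIlawL` ∕ `hIlawV4` KER′ conjunct texts -/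

section Organ

variable {ι : Type*} [Fintype ι]

/-- ★★ **ORGAN READING, BLOCK L** — `Fobs := h_Ts∘Φ`, `Law t Xw z := wNum_t Xw z ∕ ∫ wNum_t Xw`, `Sc t X′ s z := deriv (σ ↦ wNum_t (X′ σ) z) s ∕ wNum_t (X′ s) z`,
`θc := θ_j∕4`: the KER′ conjunct VERBATIM (to be paired with ✓p823910's REG′ `ilawRegSq_of_beta_of_incr`). [folklore] -/
theorem kerL_organ_mr (F : T3Family) (γ b₀ p₀ : ℝ) (j Ts : ℕ)
    (ρ ρ' : (i : ℕ) → GaugeField (F.P i) 0 ↥(Matrix.specialUnitaryGroup (Fin 2) ℂ) → ℝ) {Z : Type} [MeasurableSpace Z] (τ : Measure Z)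
    (Φ : GaugeField (F.P j) 0 ↥(Matrix.specialUnitaryGroup (Fin 2) ℂ) × Z → GaugeField (F.P Ts) 0 ↥(Matrix.specialUnitaryGroup (Fin 2) ℂ))
    (J : GaugeField (F.P j) 0 ↥(Matrix.specialUnitaryGroup (Fin 2) ℂ) × Z → NNReal)
    (rc κ M : ℝ)
    (Prof : GaugeField (F.P j) 0 ↥(Matrix.specialUnitaryGroup (Fin 2) ℂ) → (Z → ℝ) → (ι → ℝ) → Prop)
    -- (MR-L^{prof}) the law's MIXED RESPONSE (`s`-score covariance, `s′`-increment) tested against a profiled observable; `Kh`-contracted κ-row mass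
    (𝒢₁₁ : ι → PBond (F.P j) 0 → PBond (F.P j) 0 → ℝ) (Kh : ι → ℝ) (hG0 : ∀ a B B', 0 ≤ 𝒢₁₁ a B B') (hKh0 : ∀ a, 0 ≤ Kh a)
    (hmass : ∀ B, ∑ B', (∑ a, Kh a * 𝒢₁₁ a B B') * Real.exp (κ * (B.src.tdist B'.src : ℝ)) ≤ M)
    (hMR : ∀ t : ℝ, 0 ≤ t → t ≤ 1 → ∀ (B B' : PBond (F.P j) 0) (m m' : Fin 3 → ℝ) (V00 V10 V01 V11 : GaugeField (F.P j) 0 ↥(Matrix.specialUnitaryGroup (Fin 2) ℂ)),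
      ‖m‖ ≤ rc * (θBal F.L γ b₀ p₀ j / 4) → ‖m'‖ ≤ rc * (θBal F.L γ b₀ p₀ j / 4) → PlaqSmall (θBal F.L γ b₀ p₀ j / 4) V00 → PlaqSmall (θBal F.L γ b₀ p₀ j / 4) V10 → PlaqSmall (θBal F.L γ b₀ p₀ j / 4) V01 → PlaqSmall (θBal F.L γ b₀ p₀ j / 4) V11 →
      (∀ e, e ≠ B → V10 e = V00 e) → V10 B = V00 B * expPt m → (∀ e, e ≠ B' → V01 e = V00 e) → V01 B' = V00 B' * expPt m' →
      (∀ e, e ≠ B' → V11 e = V10 e) → V11 B' = V10 B' * expPt m' →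
      ∀ (Y : ℝ → GaugeField (F.P j) 0 ↥(Matrix.specialUnitaryGroup (Fin 2) ℂ)) (X : ℝ → ℝ → GaugeField (F.P j) 0 ↥(Matrix.specialUnitaryGroup (Fin 2) ℂ)),
      (∀ s e, e ≠ B → Y s e = V00 e) → (∀ s, Y s B = V00 B * expPt (s • m)) → (∀ s s' e, e ≠ B' → X s s' e = Y s e) → (∀ s s', X s s' B' = Y s B' * expPt (s' • m')) →
      ∀ s ∈ Set.Icc (0:ℝ) 1, ∀ (Pf : Z → ℝ) (p : ι → ℝ), Prof V00 Pf p →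
        |(((∫ z, Pf z * (deriv (fun s => wNum F γ b₀ p₀ j Ts ρ ρ' Φ J t (X s 1) z) s / wNum F γ b₀ p₀ j Ts ρ ρ' Φ J t (X s 1) z) * (wNum F γ b₀ p₀ j Ts ρ ρ' Φ J t (X s 1) z / ∫ z', wNum F γ b₀ p₀ j Ts ρ ρ' Φ J t (X s 1) z' ∂τ) ∂τ) - (∫ z, Pf z * (wNum F γ b₀ p₀ j Ts ρ ρ' Φ J t (X s 1) z / ∫ z', wNum F γ b₀ p₀ j Ts ρ ρ' Φ J t (X s 1) z' ∂τ) ∂τ) * (∫ z, (deriv (fun s => wNum F γ b₀ p₀ j Ts ρ ρ' Φ J t (X s 1) z) s / wNum F γ b₀ p₀ j Ts ρ ρ' Φ J t (X s 1) z) * (wNum F γ b₀ p₀ j Ts ρ ρ' Φ J t (X s 1) z / ∫ z', wNum F γ b₀ p₀ j Ts ρ ρ' Φ J t (X s 1) z' ∂τ) ∂τ)))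
            - (((∫ z, Pf z * (deriv (fun s => wNum F γ b₀ p₀ j Ts ρ ρ' Φ J t (X s 0) z) s / wNum F γ b₀ p₀ j Ts ρ ρ' Φ J t (X s 0) z) * (wNum F γ b₀ p₀ j Ts ρ ρ' Φ J t (X s 0) z / ∫ z', wNum F γ b₀ p₀ j Ts ρ ρ' Φ J t (X s 0) z' ∂τ) ∂τ) - (∫ z, Pf z * (wNum F γ b₀ p₀ j Ts ρ ρ' Φ J t (X s 0) z / ∫ z', wNum F γ b₀ p₀ j Ts ρ ρ' Φ J t (X s 0) z' ∂τ) ∂τ) * (∫ z, (deriv (fun s => wNum F γ b₀ p₀ j Ts ρ ρ' Φ J t (X s 0) z) s / wNum F γ b₀ p₀ j Ts ρ ρ' Φ J t (X s 0) z) * (wNum F γ b₀ p₀ j Ts ρ ρ' Φ J t (X s 0) z / ∫ z', wNum F γ b₀ p₀ j Ts ρ ρ' Φ J t (X s 0) z' ∂τ) ∂τ)))|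
          ≤ ‖m‖ / (θBal F.L γ b₀ p₀ j / 4) * (‖m'‖ / (θBal F.L γ b₀ p₀ j / 4)) * ∑ a, |p a| * 𝒢₁₁ a B B')
    -- (h-PROF) the flat profile of the fixed observable
    (hProfF : ∀ V00 : GaugeField (F.P j) 0 ↥(Matrix.specialUnitaryGroup (Fin 2) ℂ), PlaqSmall (θBal F.L γ b₀ p₀ j / 4) V00 → Prof V00 (fun z => (Real.log (ρ Ts (Φ (V00, z))) - Real.log (ρ' Ts (Φ (V00, z))))) Kh) :
    ∃ kL : PBond (F.P j) 0 → PBond (F.P j) 0 → ℝ, (∀ B B', 0 ≤ kL B B') ∧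
      (∀ B, ∑ B', kL B B' * Real.exp (κ * (B.src.tdist B'.src : ℝ)) ≤ M) ∧
      ∀ t : ℝ, 0 ≤ t → t ≤ 1 → ∀ (B B' : PBond (F.P j) 0) (m m' : Fin 3 → ℝ) (V00 V10 V01 V11 : GaugeField (F.P j) 0 ↥(Matrix.specialUnitaryGroup (Fin 2) ℂ)),
        ‖m‖ ≤ rc * (θBal F.L γ b₀ p₀ j / 4) → ‖m'‖ ≤ rc * (θBal F.L γ b₀ p₀ j / 4) → PlaqSmall (θBal F.L γ b₀ p₀ j / 4) V00 → PlaqSmall (θBal F.L γ b₀ p₀ j / 4) V10 → PlaqSmall (θBal F.L γ b₀ p₀ j / 4) V01 → PlaqSmall (θBal F.L γ b₀ p₀ j / 4) V11 →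
        (∀ e, e ≠ B → V10 e = V00 e) → V10 B = V00 B * expPt m → (∀ e, e ≠ B' → V01 e = V00 e) → V01 B' = V00 B' * expPt m' →
        (∀ e, e ≠ B' → V11 e = V10 e) → V11 B' = V10 B' * expPt m' →
        ∀ (Y : ℝ → GaugeField (F.P j) 0 ↥(Matrix.specialUnitaryGroup (Fin 2) ℂ)) (X : ℝ → ℝ → GaugeField (F.P j) 0 ↥(Matrix.specialUnitaryGroup (Fin 2) ℂ)),
        (∀ s e, e ≠ B → Y s e = V00 e) → (∀ s, Y s B = V00 B * expPt (s • m)) → (∀ s s' e, e ≠ B' → X s s' e = Y s e) → (∀ s s', X s s' B' = Y s B' * expPt (s' • m')) →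
        (∀ᵐ s ∂(volume : Measure ℝ), s ∈ Set.Icc (0:ℝ) 1 → |((∫ z, (Real.log (ρ Ts (Φ (V00, z))) - Real.log (ρ' Ts (Φ (V00, z)))) * (deriv (fun s => wNum F γ b₀ p₀ j Ts ρ ρ' Φ J t (X s 1) z) s / wNum F γ b₀ p₀ j Ts ρ ρ' Φ J t (X s 1) z) * (wNum F γ b₀ p₀ j Ts ρ ρ' Φ J t (X s 1) z / ∫ z', wNum F γ b₀ p₀ j Ts ρ ρ' Φ J t (X s 1) z' ∂τ) ∂τ)
                  - (∫ z, (Real.log (ρ Ts (Φ (V00, z))) - Real.log (ρ' Ts (Φ (V00, z)))) * (wNum F γ b₀ p₀ j Ts ρ ρ' Φ J t (X s 1) z / ∫ z', wNum F γ b₀ p₀ j Ts ρ ρ' Φ J t (X s 1) z' ∂τ) ∂τ) * (∫ z, (deriv (fun s => wNum F γ b₀ p₀ j Ts ρ ρ' Φ J t (X s 1) z) s / wNum F γ b₀ p₀ j Ts ρ ρ' Φ J t (X s 1) z) * (wNum F γ b₀ p₀ j Ts ρ ρ' Φ J t (X s 1) z / ∫ z', wNum F γ b₀ p₀ j Ts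 ρ ρ' Φ J t (X s 1) z' ∂τ) ∂τ))
                - ((∫ z, (Real.log (ρ Ts (Φ (V00, z))) - Real.log (ρ' Ts (Φ (V00, z)))) * (deriv (fun s => wNum F γ b₀ p₀ j Ts ρ ρ' Φ J t (X s 0) z) s / wNum F γ b₀ p₀ j Ts ρ ρ' Φ J t (X s 0) z) * (wNum F γ b₀ p₀ j Ts ρ ρ' Φ J t (X s 0) z / ∫ z', wNum F γ b₀ p₀ j Ts ρ ρ' Φ J t (X s 0) z' ∂τ) ∂τ)
                  - (∫ z, (Real.log (ρ Ts (Φ (V00, z))) - Real.log (ρ' Ts (Φ (V00, z)))) * (wNum F γ b₀ p₀ j Ts ρ ρ' Φ J t (X s 0) z / ∫ z', wNum F γ b₀ p₀ j Ts ρ ρ' Φ J t (X s 0) z' ∂τ) ∂τ) * (∫ z, (deriv (fun s => wNum F γ b₀ p₀ j Ts ρ ρ' Φ J t (X s 0) z) s / wNum F γ b₀ p₀ j Ts ρ ρ' Φ J t (X s 0) z) * (wNum F γ b₀ p₀ j Ts ρ ρ' Φ J t (X s 0) z / ∫ z', wNum F γ b₀ p₀ j Ts ρ ρ' Φ J t (X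 s 0) z' ∂τ) ∂τ))| ≤ kL B B' * (‖m‖ / (θBal F.L γ b₀ p₀ j / 4)) * (‖m'‖ / (θBal F.L γ b₀ p₀ j / 4))) := by
  exact kerLClause_of_mixedResponse τ
    (fun V z => Real.log (ρ Ts (Φ (V, z))) - Real.log (ρ' Ts (Φ (V, z))))
    (fun t Xw z => wNum F γ b₀ p₀ j Ts ρ ρ' Φ J t Xw z / ∫ z', wNum F γ b₀ p₀ j Ts ρ ρ' Φ J t Xw z' ∂τ)
    (fun t X' s z => deriv (fun s => wNum F γ b₀ p₀ j Ts ρ ρ' Φ J t (X' s) z) s / wNum F γ b₀ p₀ j Ts ρ ρ' Φ J t (X' s) z)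
    (θBal F.L γ b₀ p₀ j / 4) rc κ M Prof 𝒢₁₁ Kh hG0 hKh0 hmass hMR hProfF

/-- ★★ **ORGAN READING, BLOCK V4** — `Fobs := h_Ts∘Φ`, `Law t Xw z := wNum_t Xw z ∕ ∫ wNum_t Xw`, `Sc t X′ s z := deriv (σ ↦ wNum_t (X′ σ) z) s ∕ wNum_t (X′ s) z`,
`θc := θ_j∕4`: the KER′ conjunct VERBATIM (to be paired with ✓p823910's REG′ `ilawRegSq_of_beta_of_incr`). [folklore] -/
theorem kerV4_organ_mr (F : T3Family) (γ b₀ p₀ : ℝ) (j Ts : ℕ)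
    (ρ ρ' : (i : ℕ) → GaugeField (F.P i) 0 ↥(Matrix.specialUnitaryGroup (Fin 2) ℂ) → ℝ) {Z : Type} [MeasurableSpace Z] (τ : Measure Z)
    (Φ : GaugeField (F.P j) 0 ↥(Matrix.specialUnitaryGroup (Fin 2) ℂ) × Z → GaugeField (F.P Ts) 0 ↥(Matrix.specialUnitaryGroup (Fin 2) ℂ))
    (J : GaugeField (F.P j) 0 ↥(Matrix.specialUnitaryGroup (Fin 2) ℂ) × Z → NNReal)
    (rc κ M : ℝ)
    (Prof : GaugeField (F.P j) 0 ↥(Matrix.specialUnitaryGroup (Fin 2) ℂ) → (Z → ℝ) → (ι → ℝ) → Prop)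
    -- (MR-V4^{prof}) the law's MIXED RESPONSE of the displayed third cumulant; `Kh`-doubly-contracted κ-row mass
    (𝒢₂₂ : ι → ι → PBond (F.P j) 0 → PBond (F.P j) 0 → ℝ) (Kh : ι → ℝ) (hG0 : ∀ a b B B', 0 ≤ 𝒢₂₂ a b B B') (hKh0 : ∀ a, 0 ≤ Kh a)
    (hmass : ∀ B, ∑ B', (∑ a, ∑ b, Kh a * Kh b * 𝒢₂₂ a b B B') * Real.exp (κ * (B.src.tdist B'.src : ℝ)) ≤ M)
    (hMR : ∀ t : ℝ, 0 ≤ t → t ≤ 1 → ∀ (B B' : PBond (F.P j) 0) (m m' : Fin 3 → ℝ) (V00 V10 V01 V11 : GaugeField (F.P j) 0 ↥(Matrix.specialUnitaryGroup (Fin 2) ℂ)),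
      ‖m‖ ≤ rc * (θBal F.L γ b₀ p₀ j / 4) → ‖m'‖ ≤ rc * (θBal F.L γ b₀ p₀ j / 4) → PlaqSmall (θBal F.L γ b₀ p₀ j / 4) V00 → PlaqSmall (θBal F.L γ b₀ p₀ j / 4) V10 → PlaqSmall (θBal F.L γ b₀ p₀ j / 4) V01 → PlaqSmall (θBal F.L γ b₀ p₀ j / 4) V11 →
      (∀ e, e ≠ B → V10 e = V00 e) → V10 B = V00 B * expPt m → (∀ e, e ≠ B' → V01 e = V00 e) → V01 B' = V00 B' * expPt m' →
      (∀ e, e ≠ B' → V11 e = V10 e) → V11 B' = V10 B' * expPt m' →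
      ∀ (Y : ℝ → GaugeField (F.P j) 0 ↥(Matrix.specialUnitaryGroup (Fin 2) ℂ)) (X : ℝ → ℝ → GaugeField (F.P j) 0 ↥(Matrix.specialUnitaryGroup (Fin 2) ℂ)),
      (∀ s e, e ≠ B → Y s e = V00 e) → (∀ s, Y s B = V00 B * expPt (s • m)) → (∀ s s' e, e ≠ B' → X s s' e = Y s e) → (∀ s s', X s s' B' = Y s B' * expPt (s' • m')) →
      ∀ s ∈ Set.Icc (0:ℝ) 1, ∀ (Pf Qf : Z → ℝ) (p q : ι → ℝ), Prof V00 Pf p → Prof V00 Qf q →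
        |((((∫ z, Pf z * Qf z * (deriv (fun s => wNum F γ b₀ p₀ j Ts ρ ρ' Φ J t (X s 1) z) s / wNum F γ b₀ p₀ j Ts ρ ρ' Φ J t (X s 1) z) * (wNum F γ b₀ p₀ j Ts ρ ρ' Φ J t (X s 1) z / ∫ z', wNum F γ b₀ p₀ j Ts ρ ρ' Φ J t (X s 1) z' ∂τ) ∂τ) - (∫ z, Pf z * Qf z * (wNum F γ b₀ p₀ j Ts ρ ρ' Φ J t (X s 1) z / ∫ z', wNum F γ b₀ p₀ j Ts ρ ρ' Φ J t (X s 1) z' ∂τ) ∂τ) * (∫ z, (deriv (fun s => wNum F γ b₀ p₀ j Ts ρ ρ' Φ J t (X s 1) z) s / wNum F γ b₀ p₀ j Ts ρ ρ' Φ J t (X s 1) z) * (wNum F γ b₀ p₀ j Ts ρ ρ' Φ J t (X s 1) z / ∫ z', wNum F γ b₀ p₀ j Ts ρ ρ' Φ J t (X s 1) z' ∂τ) ∂τ))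
                - (((∫ z, Pf z * (deriv (fun s => wNum F γ b₀ p₀ j Ts ρ ρ' Φ J t (X s 1) z) s / wNum F γ b₀ p₀ j Ts ρ ρ' Φ J t (X s 1) z) * (wNum F γ b₀ p₀ j Ts ρ ρ' Φ J t (X s 1) z / ∫ z', wNum F γ b₀ p₀ j Ts ρ ρ' Φ J t (X s 1) z' ∂τ) ∂τ) - (∫ z, Pf z * (wNum F γ b₀ p₀ j Ts ρ ρ' Φ J t (X s 1) z / ∫ z', wNum F γ b₀ p₀ j Ts ρ ρ' Φ J t (X s 1) z' ∂τ) ∂τ) * (∫ z, (deriv (fun s => wNum F γ b₀ p₀ j Ts ρ ρ' Φ J t (X s 1) z) s / wNum F γ b₀ p₀ j Ts ρ ρ' Φ J t (X s 1) z) * (wNum F γ b₀ p₀ j Ts ρ ρ' Φ J t (X s 1) z / ∫ z', wNum F γ b₀ p₀ j Ts ρ ρ' Φ J t (X s 1) z' ∂τ) ∂τ)) * (∫ z, Qf z * (wNum F γ b₀ p₀ j Ts ρ ρ' Φ J t (X s 1) z / ∫ z', wNum F γ b₀ p₀ j Ts ρ ρ' Φ J t (X s 1) z' ∂τ) ∂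τ)
                    + (∫ z, Pf z * (wNum F γ b₀ p₀ j Ts ρ ρ' Φ J t (X s 1) z / ∫ z', wNum F γ b₀ p₀ j Ts ρ ρ' Φ J t (X s 1) z' ∂τ) ∂τ) * ((∫ z, Qf z * (deriv (fun s => wNum F γ b₀ p₀ j Ts ρ ρ' Φ J t (X s 1) z) s / wNum F γ b₀ p₀ j Ts ρ ρ' Φ J t (X s 1) z) * (wNum F γ b₀ p₀ j Ts ρ ρ' Φ J t (X s 1) z / ∫ z', wNum F γ b₀ p₀ j Ts ρ ρ' Φ J t (X s 1) z' ∂τ) ∂τ) - (∫ z, Qf z * (wNum F γ b₀ p₀ j Ts ρ ρ' Φ J t (X s 1) z / ∫ z', wNum F γ b₀ p₀ j Ts ρ ρ' Φ J t (X s 1) z' ∂τ) ∂τ) * (∫ z, (deriv (fun s => wNum F γ b₀ p₀ j Ts ρ ρ' Φ J t (X s 1) z) s / wNum F γ b₀ p₀ j Ts ρ ρ' Φ J t (X s 1) z) * (wNum F γ b₀ p₀ j Ts ρ ρ' Φ J t (X s 1) z / ∫ z', wNum F γ b₀ p₀ j Ts ρ ρ' Φ J t (X s 1) z' ∂τ)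 ∂τ)))))
            - ((((∫ z, Pf z * Qf z * (deriv (fun s => wNum F γ b₀ p₀ j Ts ρ ρ' Φ J t (X s 0) z) s / wNum F γ b₀ p₀ j Ts ρ ρ' Φ J t (X s 0) z) * (wNum F γ b₀ p₀ j Ts ρ ρ' Φ J t (X s 0) z / ∫ z', wNum F γ b₀ p₀ j Ts ρ ρ' Φ J t (X s 0) z' ∂τ) ∂τ) - (∫ z, Pf z * Qf z * (wNum F γ b₀ p₀ j Ts ρ ρ' Φ J t (X s 0) z / ∫ z', wNum F γ b₀ p₀ j Ts ρ ρ' Φ J t (X s 0) z' ∂τ) ∂τ) * (∫ z, (deriv (fun s => wNum F γ b₀ p₀ j Ts ρ ρ' Φ J t (X s 0) z) s / wNum F γ b₀ p₀ j Ts ρ ρ' Φ J t (X s 0) z) * (wNum F γ b₀ p₀ j Ts ρ ρ' Φ J t (X s 0) z / ∫ z', wNum F γ b₀ p₀ j Ts ρ ρ' Φ J t (X s 0) z' ∂τ) ∂τ))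
                - (((∫ z, Pf z * (deriv (fun s => wNum F γ b₀ p₀ j Ts ρ ρ' Φ J t (X s 0) z) s / wNum F γ b₀ p₀ j Ts ρ ρ' Φ J t (X s 0) z) * (wNum F γ b₀ p₀ j Ts ρ ρ' Φ J t (X s 0) z / ∫ z', wNum F γ b₀ p₀ j Ts ρ ρ' Φ J t (X s 0) z' ∂τ) ∂τ) - (∫ z, Pf z * (wNum F γ b₀ p₀ j Ts ρ ρ' Φ J t (X s 0) z / ∫ z', wNum F γ b₀ p₀ j Ts ρ ρ' Φ J t (X s 0) z' ∂τ) ∂τ) * (∫ z, (deriv (fun s => wNum F γ b₀ p₀ j Ts ρ ρ' Φ J t (X s 0) z) s / wNum F γ b₀ p₀ j Ts ρ ρ' Φ J t (X s 0) z) * (wNum F γ b₀ p₀ j Ts ρ ρ' Φ J t (X s 0) z / ∫ z', wNum F γ b₀ p₀ j Ts ρ ρ' Φ J t (X s 0) z' ∂τ) ∂τ)) * (∫ z, Qf z * (wNum F γ b₀ p₀ j Ts ρ ρ' Φ J t (X s 0) z / ∫ z', wNum F γ b₀ p₀ j Ts ρ ρ' Φ J t (X s 0) z' ∂τ) ∂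τ)
                    + (∫ z, Pf z * (wNum F γ b₀ p₀ j Ts ρ ρ' Φ J t (X s 0) z / ∫ z', wNum F γ b₀ p₀ j Ts ρ ρ' Φ J t (X s 0) z' ∂τ) ∂τ) * ((∫ z, Qf z * (deriv (fun s => wNum F γ b₀ p₀ j Ts ρ ρ' Φ J t (X s 0) z) s / wNum F γ b₀ p₀ j Ts ρ ρ' Φ J t (X s 0) z) * (wNum F γ b₀ p₀ j Ts ρ ρ' Φ J t (X s 0) z / ∫ z', wNum F γ b₀ p₀ j Ts ρ ρ' Φ J t (X s 0) z' ∂τ) ∂τ) - (∫ z, Qf z * (wNum F γ b₀ p₀ j Ts ρ ρ' Φ J t (X s 0) z / ∫ z', wNum F γ b₀ p₀ j Ts ρ ρ' Φ J t (X s 0) z' ∂τ) ∂τ) * (∫ z, (deriv (fun s => wNum F γ b₀ p₀ j Ts ρ ρ' Φ J t (X s 0) z) s / wNum F γ b₀ p₀ j Ts ρ ρ' Φ J t (X s 0) z) * (wNum F γ b₀ p₀ j Ts ρ ρ' Φ J t (X s 0) z / ∫ z', wNum F γ b₀ p₀ j Ts ρ ρ' Φ J t (X s 0) z' ∂τ)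 ∂τ)))))|
          ≤ ‖m‖ / (θBal F.L γ b₀ p₀ j / 4) * (‖m'‖ / (θBal F.L γ b₀ p₀ j / 4)) * ∑ a, ∑ b, |p a| * |q b| * 𝒢₂₂ a b B B')
    -- (h-PROF)
    (hProfF : ∀ V00 : GaugeField (F.P j) 0 ↥(Matrix.specialUnitaryGroup (Fin 2) ℂ), PlaqSmall (θBal F.L γ b₀ p₀ j / 4) V00 → Prof V00 (fun z => (Real.log (ρ Ts (Φ (V00, z))) - Real.log (ρ' Ts (Φ (V00, z))))) Kh) :
    ∃ kV₄ : PBond (F.P j) 0 → PBond (F.P j) 0 → ℝ, (∀ B B', 0 ≤ kV₄ B B') ∧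
      (∀ B, ∑ B', kV₄ B B' * Real.exp (κ * (B.src.tdist B'.src : ℝ)) ≤ M) ∧
      ∀ t : ℝ, 0 ≤ t → t ≤ 1 → ∀ (B B' : PBond (F.P j) 0) (m m' : Fin 3 → ℝ) (V00 V10 V01 V11 : GaugeField (F.P j) 0 ↥(Matrix.specialUnitaryGroup (Fin 2) ℂ)),
        ‖m‖ ≤ rc * (θBal F.L γ b₀ p₀ j / 4) → ‖m'‖ ≤ rc * (θBal F.L γ b₀ p₀ j / 4) → PlaqSmall (θBal F.L γ b₀ p₀ j / 4) V00 → PlaqSmall (θBal F.L γ b₀ p₀ j / 4) V10 → PlaqSmall (θBal F.L γ b₀ p₀ j / 4) V01 → PlaqSmall (θBal F.L γ b₀ p₀ j / 4) V11 →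
        (∀ e, e ≠ B → V10 e = V00 e) → V10 B = V00 B * expPt m → (∀ e, e ≠ B' → V01 e = V00 e) → V01 B' = V00 B' * expPt m' →
        (∀ e, e ≠ B' → V11 e = V10 e) → V11 B' = V10 B' * expPt m' →
        ∀ (Y : ℝ → GaugeField (F.P j) 0 ↥(Matrix.specialUnitaryGroup (Fin 2) ℂ)) (X : ℝ → ℝ → GaugeField (F.P j) 0 ↥(Matrix.specialUnitaryGroup (Fin 2) ℂ)),
        (∀ s e, e ≠ B → Y s e = V00 e) → (∀ s, Y s B = V00 B * expPt (s • m)) → (∀ s s' e, e ≠ B' → X s s' e = Y s e) → (∀ s s', X s s' B' = Y s B' * expPt (s' • m')) →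
        (∀ᵐ s ∂(volume : Measure ℝ), s ∈ Set.Icc (0:ℝ) 1 → |(((∫ z, ((Real.log (ρ Ts (Φ (V00, z))) - Real.log (ρ' Ts (Φ (V00, z)))) * (Real.log (ρ Ts (Φ (V00, z))) - Real.log (ρ' Ts (Φ (V00, z))))) * (deriv (fun s => wNum F γ b₀ p₀ j Ts ρ ρ' Φ J t (X s 1) z) s / wNum F γ b₀ p₀ j Ts ρ ρ' Φ J t (X s 1) z) * (wNum F γ b₀ p₀ j Ts ρ ρ' Φ J t (X s 1) z / ∫ z', wNum F γ b₀ p₀ j Ts ρ ρ' Φ J t (X s 1) z' ∂τ) ∂τ) - (∫ z, ((Real.log (ρ Ts (Φ (V00, z))) - Real.log (ρ' Ts (Φ (V00, z)))) * (Real.log (ρ Ts (Φ (V00, z))) - Real.log (ρ' Ts (Φ (V00, z))))) * (wNum F γ b₀ p₀ j Ts ρ ρ' Φ J t (X s 1) z / ∫ z', wNum F γ b₀ p₀ j Ts ρ ρ' Φ J t (X s 1) z' ∂τ) ∂τ) * (∫ z, (deriv (fun s => wNum F γ b₀ p₀ j Ts ρ ρ' Φ J t (X s 1) z) s / wNum F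 γ b₀ p₀ j Ts ρ ρ' Φ J t (X s 1) z) * (wNum F γ b₀ p₀ j Ts ρ ρ' Φ J t (X s 1) z / ∫ z', wNum F γ b₀ p₀ j Ts ρ ρ' Φ J t (X s 1) z' ∂τ) ∂τ))
                  - (((∫ z, (Real.log (ρ Ts (Φ (V00, z))) - Real.log (ρ' Ts (Φ (V00, z)))) * (deriv (fun s => wNum F γ b₀ p₀ j Ts ρ ρ' Φ J t (X s 1) z) s / wNum F γ b₀ p₀ j Ts ρ ρ' Φ J t (X s 1) z) * (wNum F γ b₀ p₀ j Ts ρ ρ' Φ J t (X s 1) z / ∫ z', wNum F γ b₀ p₀ j Ts ρ ρ' Φ J t (X s 1) z' ∂τ) ∂τ) - (∫ z, (Real.log (ρ Ts (Φ (V00, z))) - Real.log (ρ' Ts (Φ (V00, z)))) * (wNum F γ b₀ p₀ j Ts ρ ρ' Φ J t (X s 1) z / ∫ z', wNum F γ b₀ p₀ j Ts ρ ρ' Φ J t (X s 1) z' ∂τ) ∂τ) * (∫ z, (deriv (fun s => wNum F γ b₀ p₀ j Ts ρ ρ' Φ J t (X s 1) z) s / wNum F γ b₀ p₀ j Ts ρ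 ρ' Φ J t (X s 1) z) * (wNum F γ b₀ p₀ j Ts ρ ρ' Φ J t (X s 1) z / ∫ z', wNum F γ b₀ p₀ j Ts ρ ρ' Φ J t (X s 1) z' ∂τ) ∂τ)) * (∫ z, (Real.log (ρ Ts (Φ (V00, z))) - Real.log (ρ' Ts (Φ (V00, z)))) * (wNum F γ b₀ p₀ j Ts ρ ρ' Φ J t (X s 1) z / ∫ z', wNum F γ b₀ p₀ j Ts ρ ρ' Φ J t (X s 1) z' ∂τ) ∂τ)
                    + (∫ z, (Real.log (ρ Ts (Φ (V00, z))) - Real.log (ρ' Ts (Φ (V00, z)))) * (wNum F γ b₀ p₀ j Ts ρ ρ' Φ J t (X s 1) z / ∫ z', wNum F γ b₀ p₀ j Ts ρ ρ' Φ J t (X s 1) z' ∂τ) ∂τ) * ((∫ z, (Real.log (ρ Ts (Φ (V00, z))) - Real.log (ρ' Ts (Φ (V00, z)))) * (deriv (fun s => wNum F γ b₀ p₀ j Ts ρ ρ' Φ J t (X s 1) z) s / wNum F γ b₀ p₀ j Ts ρ ρ' Φ J t (X s 1) z) * (wNum F γ b₀ p₀ j Ts ρ ρ' Φ J t (X s 1)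 z / ∫ z', wNum F γ b₀ p₀ j Ts ρ ρ' Φ J t (X s 1) z' ∂τ) ∂τ) - (∫ z, (Real.log (ρ Ts (Φ (V00, z))) - Real.log (ρ' Ts (Φ (V00, z)))) * (wNum F γ b₀ p₀ j Ts ρ ρ' Φ J t (X s 1) z / ∫ z', wNum F γ b₀ p₀ j Ts ρ ρ' Φ J t (X s 1) z' ∂τ) ∂τ) * (∫ z, (deriv (fun s => wNum F γ b₀ p₀ j Ts ρ ρ' Φ J t (X s 1) z) s / wNum F γ b₀ p₀ j Ts ρ ρ' Φ J t (X s 1) z) * (wNum F γ b₀ p₀ j Ts ρ ρ' Φ J t (X s 1) z / ∫ z', wNum F γ b₀ p₀ j Ts ρ ρ' Φ J t (X s 1) z' ∂τ) ∂τ))))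
                - (((∫ z, ((Real.log (ρ Ts (Φ (V00, z))) - Real.log (ρ' Ts (Φ (V00, z)))) * (Real.log (ρ Ts (Φ (V00, z))) - Real.log (ρ' Ts (Φ (V00, z))))) * (deriv (fun s => wNum F γ b₀ p₀ j Ts ρ ρ' Φ J t (X s 0) z) s / wNum F γ b₀ p₀ j Ts ρ ρ' Φ J t (X s 0) z) * (wNum F γ b₀ p₀ j Ts ρ ρ' Φ J t (X s 0) z / ∫ z', wNum F γ b₀ p₀ j Ts ρ ρ' Φ J t (X s 0) z' ∂τ) ∂τ) - (∫ z, ((Real.log (ρ Ts (Φ (V00, z))) - Real.log (ρ' Ts (Φ (V00, z)))) * (Real.log (ρ Ts (Φ (V00, z))) - Real.log (ρ' Ts (Φ (V00, z))))) * (wNum F γ b₀ p₀ j Ts ρ ρ' Φ J t (X s 0) z / ∫ z', wNum F γ b₀ p₀ j Ts ρ ρ' Φ J t (X s 0) z' ∂τ) ∂τ) * (∫ z, (deriv (fun s => wNum F γ b₀ p₀ j Ts ρ ρ' Φ J t (X s 0) z) s / wNum F γ b₀ p₀ j Ts ρ ρ' Φ J t (X s 0) z) * (wNum F γ b₀ p₀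 j Ts ρ ρ' Φ J t (X s 0) z / ∫ z', wNum F γ b₀ p₀ j Ts ρ ρ' Φ J t (X s 0) z' ∂τ) ∂τ))
                  - (((∫ z, (Real.log (ρ Ts (Φ (V00, z))) - Real.log (ρ' Ts (Φ (V00, z)))) * (deriv (fun s => wNum F γ b₀ p₀ j Ts ρ ρ' Φ J t (X s 0) z) s / wNum F γ b₀ p₀ j Ts ρ ρ' Φ J t (X s 0) z) * (wNum F γ b₀ p₀ j Ts ρ ρ' Φ J t (X s 0) z / ∫ z', wNum F γ b₀ p₀ j Ts ρ ρ' Φ J t (X s 0) z' ∂τ) ∂τ) - (∫ z, (Real.log (ρ Ts (Φ (V00, z))) - Real.log (ρ' Ts (Φ (V00, z)))) * (wNum F γ b₀ p₀ j Ts ρ ρ' Φ J t (X s 0) z / ∫ z', wNum F γ b₀ p₀ j Ts ρ ρ' Φ J t (X s 0) z' ∂τ) ∂τ) * (∫ z, (deriv (fun s => wNum F γ b₀ p₀ j Ts ρ ρ' Φ J t (X s 0) z) s / wNum F γ b₀ p₀ j Ts ρ ρ' Φ J t (X s 0) z) * (wNum F γ b₀ p₀ j Ts ρ ρ' Φ J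 t (X s 0) z / ∫ z', wNum F γ b₀ p₀ j Ts ρ ρ' Φ J t (X s 0) z' ∂τ) ∂τ)) * (∫ z, (Real.log (ρ Ts (Φ (V00, z))) - Real.log (ρ' Ts (Φ (V00, z)))) * (wNum F γ b₀ p₀ j Ts ρ ρ' Φ J t (X s 0) z / ∫ z', wNum F γ b₀ p₀ j Ts ρ ρ' Φ J t (X s 0) z' ∂τ) ∂τ)
                    + (∫ z, (Real.log (ρ Ts (Φ (V00, z))) - Real.log (ρ' Ts (Φ (V00, z)))) * (wNum F γ b₀ p₀ j Ts ρ ρ' Φ J t (X s 0) z / ∫ z', wNum F γ b₀ p₀ j Ts ρ ρ' Φ J t (X s 0) z' ∂τ) ∂τ) * ((∫ z, (Real.log (ρ Ts (Φ (V00, z))) - Real.log (ρ' Ts (Φ (V00, z)))) * (deriv (fun s => wNum F γ b₀ p₀ j Ts ρ ρ' Φ J t (X s 0) z) s / wNum F γ b₀ p₀ j Ts ρ ρ' Φ J t (X s 0) z) * (wNum F γ b₀ p₀ j Ts ρ ρ' Φ J t (X s 0) z / ∫ z', wNum F γ b₀ p₀ j Ts ρ ρ' Φ J t (X s 0) z'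 ∂τ) ∂τ) - (∫ z, (Real.log (ρ Ts (Φ (V00, z))) - Real.log (ρ' Ts (Φ (V00, z)))) * (wNum F γ b₀ p₀ j Ts ρ ρ' Φ J t (X s 0) z / ∫ z', wNum F γ b₀ p₀ j Ts ρ ρ' Φ J t (X s 0) z' ∂τ) ∂τ) * (∫ z, (deriv (fun s => wNum F γ b₀ p₀ j Ts ρ ρ' Φ J t (X s 0) z) s / wNum F γ b₀ p₀ j Ts ρ ρ' Φ J t (X s 0) z) * (wNum F γ b₀ p₀ j Ts ρ ρ' Φ J t (X s 0) z / ∫ z', wNum F γ b₀ p₀ j Ts ρ ρ' Φ J t (X s 0) z' ∂τ) ∂τ))))| ≤ kV₄ B B' * (‖m‖ / (θBal F.L γ b₀ p₀ j / 4)) * (‖m'‖ / (θBal F.L γ b₀ p₀ j / 4))) := by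
  exact kerV4Clause_of_mixedResponse₂ τ
    (fun V z => Real.log (ρ Ts (Φ (V, z))) - Real.log (ρ' Ts (Φ (V, z))))
    (fun t Xw z => wNum F γ b₀ p₀ j Ts ρ ρ' Φ J t Xw z / ∫ z', wNum F γ b₀ p₀ j Ts ρ ρ' Φ J t Xw z' ∂τ)
    (fun t X' s z => deriv (fun s => wNum F γ b₀ p₀ j Ts ρ ρ' Φ J t (X' s) z) s / wNum F γ b₀ p₀ j Ts ρ ρ' Φ J t (X' s) z)
    (θBal F.L γ b₀ p₀ j / 4) rc κ M Prof 𝒢₂₂ Kh hG0 hKh0 hmass hMR hProfF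

end Organ

end Summit.QuantumFields.YangMills.Theorems.OrganTangentILawKerSqOfMixedResponse

end
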